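import Mathlib
import Summits.Ventures.FusionMHD.Models.CerfonFreidbergIterLikeQ90Defs
import HarnessLib

/-!
# Ventures/FusionMHD — Models/CerfonFreidbergIterLikeQ90Panels8.lean: KERNEL CHECK of panels 27, 28, 29 (of 32) of the
# certified safety factor `q(ψ_N = 9/10)/F` of THE Cerfon–Freidberg ITER-like instance (sibling of `…IterLikeQHalfPanels*.lean`)

HONEST FRAMING (LADDER-GRIDFUSION three columns; CF rung, F2 item R2, q-profile sample).  One `decide +kernel` (≈ 103 s on the farm): for
each panel `j` listed, the per-panel obligation `CFIterLike.Q90.PanelCert.ok` (`Models/CerfonFreidbergIterLikeQ90Defs.lean`) — the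
Taylor-model run of `CFIterLike.Q90.progG` over the ITER-like parameter box is ACCEPTED (every `log`/`sin`/`cos` composition and the `inv`
certificate), and the kernel's panel-integral enclosure of the polar `(6.35)` integrand along the approximant, the range of the flux residual
`U(ray m) − U_a/10`, the range of the approximant `m` and the range of the radial derivative `D_r(θ, m)` lie inside the integers claimed in
`panelCert8` (values read off a compiled `#eval` of the same functions, slack one unit of `2⁻⁶⁰`; probe `QProbeIF*.lean`, generator
`pub/gridfusion/models/gen-model-5/g8/gen90/mkdefsN.py`).  What these Booleans MEAN (real-number statements, uniformly over the parameter box ∋ THE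
ITER-like instance) is proved once in `Models/CerfonFreidbergIterLikeQ90Sound.lean`.  MODELLED: analytic Cerfon–Freidberg family; `q` of a
MODEL surface — nothing about a device or stability.  No `native_decide`.  Typer/prover: gridfusion-model-5 (g8), 2026-08-27.
Citations: Freidberg 2014 §6.3.5 (6.35) [Freidberg2014]; Mahboubi–Melquiond–Sibut-Pinote 2016 §3.2 Lemma 3 [MahboubiMelquiondSibutpinote2016].
-/

namespace Summit.Ventures.FusionMHD.Models.CFIterLike.Q90

/-- The certificate data of panels 27, 28, 29 (`ψ_N = 9/10`): `inv` candidate (degree-12 fit of `(X·D_r)⁻¹` in the panel variable, scaled by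
`2⁶⁰`), Taylor degree, `inv` widening `2^elog2`, and the claimed integral / residual / `m`-range / `D_r`-range integers (× `2⁶⁰`). [instance data] -/
def panelCert8 : List PanelCert := [
  { j := 27, cand := [11342837693385986048, -15552338656269936640, 66602863784763768832, -69344581983726952448, -39747688936204492800, 1491009779994743799808, -8303786628607765381120, 35459366669931419533312, -123183580455490558099456, 324919399559636522631168, 3131191274698742073131008, 8366575219080628344455168, -4542441241427828720720150528],
    deg := 10, elog2 := 35, plo := 413347801848597116, phi := 413347804630575835, eta := 43979766, mlo := 419491332021781840, mhi := 435570152529288132,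
    dlo := 160840262344277414, dhi := 169160950244710564 },
  { j := 28, cand := [10919752466299834368, -11591839507516112896, 60224477590158508032, -63816841065216524288, 102446732988087222272, 488331984404725432320, -3145140822898493620224, 14565007317537640153088, -54716959205757999382528, 192638072130295767760896, 5674047343467633764728832, -45691620937869096436891648, -8623226753588043763882655744],
    deg := 10, elog2 := 34, plo := 385599278725256871, phi := 385599280169673830, eta := 42644886, mlo := 408184690015236926, mhi := 420460981264052810,
    dlo := 168770869610920660, dhi := 175538397195923523 },
  { j := 29, cand := [10614482617673109504, -8000417373796476928, 54953846177427537920, -47752632837692227584, 145236189450565255168, 123595266480943136768, -1062395498102563667968, 5763371151211113742336, -20228343034405585944576, 79106055419313187192832, -5186459980783630516486144, -14301547779248027334606848, 6124715392601299525180588032],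
    deg := 12, elog2 := 34, plo := 366085886829073948, phi := 366085888210434421, eta := 38552422, mlo := 400322674099556925, mhi := 409080518940713530,
    dlo := 175111633360575916, dhi := 180176366352088811 }]

/-- **KERNEL CHECK** of panels 27, 28, 29 of the ITER-like surface `ψ_N = 9/10`. -/
theorem panelCert8_ok : CFIterLike.Q90.panelCert8.all PanelCert.ok = true := by
  decide +kernel

end Summit.Ventures.FusionMHD.Models.CFIterLike.Q90
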